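import Summits.ResolutionOfSingularities.ResolutionOfSingularities.Theorems.PurelyInseparableDim4AtlasMemberDefs
import HarnessLib

/-!
# Purely inseparable four-folds: ATLAS MEMBERS with FIBRE-CLOSED readings (brick S3 (c) v4, tranche 1, definitions part 2; cell `res-dim4-pi`)

[OURS · counted 0] (D-0157 DOOR 2; host item stmt-ResolutionOfSingularities-16155, helper). Nothing here proves resolution of
singularities in dimension ≥ 4 / characteristic `p`. NO theorem content. One clause is ADDED to `MemberAtlasZ` (p711312), found necessary
on paper for the child package A1 (`res-dim4-typ-3/S3c-V4-ATLAS-MEMBERS-DESIGN.md` §9 (I6)): the chart image of an atlas reading is NOT closed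
in the stage (the member continues into the other charts), so v3's closedness hypothesis `IsClosed (φ(ψ⁻¹ V(z, x_T)))` of `child_package` fails;
what IS closed, and what the child package needs, is the image of `V(z, x_T)` with the BUNDLE DIRECTIONS FIXED at any values
(`ownedSetZ T {(m, v_m) : m ∈ D}` — the base times one fibre point). `MemberAtlasZF` = `MemberAtlasZ` ∧ this FIBRE-CLOSEDNESS per reading;
`MemberDataAF` = `MemberDataA` over it.

* `MemberAtlasZF`, `MemberDataAF`. AI-produced formalisation, weaker than expert review.
bears_on: LADDER-RESOLUTION:D157-DOOR2 (res-dim4-pi · S3 (c) v4 atlas members · defs 2).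
-/

set_option linter.dupNamespace false -- D-0017: single-problem summit path `Summit.<S>.<S>.…` by design

noncomputable section

open MvPolynomial Finset CategoryTheory AlgebraicGeometry Opposite TopologicalSpace
open AlgebraicGeometry.Scheme.IdealSheafData (ofIdealTop vanishingIdeal)

namespace Summit.ResolutionOfSingularities.ResolutionOfSingularities.Theorems.PIDim4

open Literature.AlgebraicGeometry.Resolution
open Literature.AlgebraicGeometry.Resolution.Hauser2010
open Literature.AlgebraicGeometry.Resolution.AffinePointBlowup (P A γ coord Wtop ξ)

namespace Equimultiple

section DefsAF

variable {K : Type} [Field K] (p : ℕ) [DecidableEq K] {X' : Scheme.{0}}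

/-- **Atlas clause with FIBRE-CLOSED readings**: `MemberAtlasZ` (one zigzag per reading, v3 dictionary, cover by owned parts, disjointness)
AND, for every reading `(s, T, X, D)` and every value vector `v`, the image `φ(ψ⁻¹ (V(z, x_T) ∩ {x_m = v_m : m ∈ D}))` is CLOSED in the stage
(the member's base times one point of its bundle fibre). [cite: BierstoneGrigorievMilmanWlodarczyk2011, Def. 3.1.3 (2), (4)] [cite: Hauser2010, §G] -/
def MemberAtlasZF (M' : MarkedIdeal X') (c : Closeds X') (R : Finset (AReading K)) : Prop :=
  ∃ (Y : ↥R → Scheme.{0}) (φ : ∀ r : ↥R, Y r ⟶ X') (ψ : ∀ r : ↥R, Y r ⟶ P 4 K),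
    (∀ r : ↥R, IsOpenImmersion (φ r) ∧ IsOpenImmersion (ψ r) ∧
      M'.ideal.comap (φ r) = (hypSheaf p r.1.1.F).comap (ψ r) ∧
      (vanishingIdeal c).comap (φ r) = (AffineCoordBlowup.𝓘Λ 4 K (insert 0 (Fin.succ '' (r.1.2.1 : Set (Fin 4))))).comap (ψ r) ∧
      (AffineCoordBlowup.CΛ 4 K (insert 0 (Fin.succ '' (r.1.2.1 : Set (Fin 4)))) : Set (P 4 K)) ⊆ Set.range (ψ r) ∧
      (∀ v : Fin 4 → K, IsClosed (φ r '' (ψ r ⁻¹' ownedSetZ r.1.2.1 (r.1.2.2.2.image fun m => (m, v m))))) ∧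
      ∃ (idx : X'.IdealSheafData → Fin 4) (cst_ : X'.IdealSheafData → K),
        (∀ D ∈ M'.boundary,
          ((D.support : Set X') ∩ φ r '' (ψ r ⁻¹'
            (AffineCoordBlowup.CΛ 4 K (insert 0 (Fin.succ '' (r.1.2.1 : Set (Fin 4)))) : Set (P 4 K)))).Nonempty →
          D.comap (φ r) = (ofIdealTop (Ideal.span {(γ 4 K).symm (X (idx D).succ + C (cst_ D))})).comap (ψ r) ∧
            (idx D ∈ r.1.2.1 → cst_ D = 0)) ∧
        (∀ D₁ ∈ M'.boundary, ∀ D₂ ∈ M'.boundary,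
          ((D₁.support : Set X') ∩ φ r '' (ψ r ⁻¹'
            (AffineCoordBlowup.CΛ 4 K (insert 0 (Fin.succ '' (r.1.2.1 : Set (Fin 4)))) : Set (P 4 K)))).Nonempty →
          ((D₂.support : Set X') ∩ φ r '' (ψ r ⁻¹'
            (AffineCoordBlowup.CΛ 4 K (insert 0 (Fin.succ '' (r.1.2.1 : Set (Fin 4)))) : Set (P 4 K)))).Nonempty →
          idx D₁ = idx D₂ → D₁ = D₂)) ∧
    (c : Set X') ⊆ ⋃ r : ↥R, φ r '' (ψ r ⁻¹' ownedSetZ r.1.2.1 r.1.2.2.1) ∧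
    ∀ r r' : ↥R, r ≠ r' →
      Disjoint (φ r '' (ψ r ⁻¹' ownedSetZ r.1.2.1 r.1.2.2.1)) (φ r' '' (ψ r' ⁻¹' ownedSetZ r'.1.2.1 r'.1.2.2.1))

/-- **The full datum of an atlas member with fibre-closed readings**: `MemberDataA` (p711312) with `MemberAtlasZF` in place of `MemberAtlasZ`.
[cite: BierstoneGrigorievMilmanWlodarczyk2011, Def. 3.1.3] [cite: Hauser2010, §§F–G] -/
def MemberDataAF [IsAlgClosed K] [CharP K p] [Fact p.Prime]
    (plan : AReading K → Finset (Fin 4 × (Fin 4 → K) × Finset (Fin 4)))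
    (leaves : AReading K → Finset (Fin 4 × (Fin 4 → K)))
    (M' : MarkedIdeal X') (c : Closeds X') (R : Finset (AReading K)) : Prop :=
  (∀ r ∈ R, r.1.F ≠ 0 ∧ Literature.Barriers.ResolutionOfSingularities.HauserPerlega.IsClean p r.1.F ∧ IsPermissibleCentre p r.2.1 r.1.F) ∧
  Scheme.IsRegular (vanishingIdeal c).subscheme ∧ HasSNCWith M'.boundary (vanishingIdeal c) ∧
  MemberAtlasZF p M' c R ∧
  (∀ r ∈ R, ∀ q : AReading K,
    Relation.ReflTransGen (fun a b : AReading K => AEdge p plan b a) r q → BlockA p plan leaves q) ∧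
  (∀ r ∈ R, Acc (fun q' q : AReading K => AEdge p plan q' q) r) ∧
  (∀ D ∈ M'.boundary, ((D.support : Set X') ∩ (c : Set X')).Nonempty → (c : Set X') ⊆ D.support)

end DefsAF

end Equimultiple

end Summit.ResolutionOfSingularities.ResolutionOfSingularities.Theorems.PIDim4

end
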